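import Summits.PneNP.PneNP.Theses.KarlinRubin

/-!
# Crux `MonotoneSuffices` (stmt-PneNP-18026), line `Sketch` (compression) — stub `stub_nullMass`

The down-up compression (coordinate polarization) of a test `f : EdgeVec n → Bool` along an edge
coordinate `e`,
`S_e f (x) = (f x[e←0] ∧ f x[e←1]) ∨ (x_e ∧ (f x[e←0] ∨ f x[e←1]))`,
replaces on every `e`-edge `{x[e←0], x[e←1]}` of the cube the pair of values `(f x[e←0], f x[e←1])`
by `(min, max)`. The stub `stub_nullMass` says that under the null law `erdosRenyiHalf n`
(`= PMF.uniformOfFintype (EdgeVec n)`, i.e. `G(n,1/2)`) the acceptance set of `S_e f` has the same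
mass as that of `f` (type-I error is preserved EXACTLY).

Proof. `S_e f = f ∘ σ` for the "sorting involution" `σ` of the cube which swaps the two endpoints
of an `e`-edge exactly when `f` is strictly decreasing along it (`f x[e←0] = 1`, `f x[e←1] = 0`) and
fixes all other points (`nullMass_compress_eq_apply_swap`, `nullMass_swap_involutive`). Hence the
acceptance sets of `S_e f` and `f` are in bijection (`Equiv.subtypeEquiv` along `σ`), so they have
the same cardinality, and the uniform measure of a set is its cardinality over that of the cube
(`PMF.toOuterMeasure_uniformOfFintype_apply`).
-/

set_option linter.dupNamespace false -- `Summit.PneNP.PneNP.…`: summit = sub-problem name (D-0017 single-conjunct layout)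

namespace Summit.PneNP.PneNP.Theorems.MonotoneSuffices.Compression

open Literature.Computability.Complexity Literature.Probability.RandomGraphs.PlantedClique Filter Finset
open Function (update)

/-- The compression `S_e f` is `f` precomposed with the sorting map `σ`: `σ x` flips the `e`-bit of `x`
when `f x[e←0] = true` and `f x[e←1] = false`, and `σ x = x` otherwise. [folklore] -/
theorem nullMass_compress_eq_apply_swap {n : ℕ} (e : (⊤ : SimpleGraph (Fin n)).edgeSet)
    (f : EdgeVec n → Bool) (x : EdgeVec n) :
    ((f (update x e false) && f (update x e true)) ||
        (x e && (f (update x e false) || f (update x e true)))) =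
      f (if f (update x e false) = true ∧ f (update x e true) = false then update x e (!x e) else x) := by
  cases hx : x e
  · have h0 : update x e false = x := by rw [← hx, Function.update_eq_self]
    simp only [h0, Bool.false_and, Bool.or_false, Bool.not_false]
    cases h1 : f x <;> cases h2 : f (update x e true) <;> simp [h1, h2]
  · have h1 : update x e true = x := by rw [← hx, Function.update_eq_self]
    simp only [h1, Bool.true_and, Bool.not_true]
    cases h0 : f (update x e false) <;> cases h2 : f x <;> simp [h0, h2]

/-- The sorting map `σ` of `nullMass_compress_eq_apply_swap` is an involution of the cube (the swap
condition only depends on the `e`-edge through `x`, not on the `e`-bit of `x`). [folklore] -/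
theorem nullMass_swap_involutive {n : ℕ} (e : (⊤ : SimpleGraph (Fin n)).edgeSet)
    (f : EdgeVec n → Bool) :
    Function.Involutive (fun x : EdgeVec n =>
      if f (update x e false) = true ∧ f (update x e true) = false then update x e (!x e) else x) := by
  intro x
  by_cases h : f (update x e false) = true ∧ f (update x e true) = false
  · simp only [if_pos h, Function.update_self, Bool.not_not, Function.update_idem,
      Function.update_eq_self]
  · simp only [if_neg h]

/-- **stub_nullMass** (type I is preserved EXACTLY under compression). For every test `f` and every
edge coordinate `e`, the `G(n,1/2)`-mass of the acceptance set of the compression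
`S_e f (x) = (f x[e←0] ∧ f x[e←1]) ∨ (x_e ∧ (f x[e←0] ∨ f x[e←1]))` equals that of `f`: the null law
`erdosRenyiHalf n` is uniform on the cube (`PMF.uniformOfFintype`), and `S_e f = f ∘ σ` for the
sorting involution `σ` (`nullMass_compress_eq_apply_swap`, `nullMass_swap_involutive`), so the two
acceptance sets are in bijection and have the same number of points. [folklore] -/
theorem stub_nullMass :
    ∀ (n : ℕ) (e : (⊤ : SimpleGraph (Fin n)).edgeSet) (f : EdgeVec n → Bool),
      (erdosRenyiHalf n).toOuterMeasure
          {x | ((f (update x e false) && f (update x e true)) ||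
              (x e && (f (update x e false) || f (update x e true)))) = true} =
        (erdosRenyiHalf n).toOuterMeasure {x | f x = true} := by
  intro n e f
  classical
  unfold erdosRenyiHalf
  rw [PMF.toOuterMeasure_uniformOfFintype_apply, PMF.toOuterMeasure_uniformOfFintype_apply]
  congr 1
  exact_mod_cast Fintype.card_congr
    (((nullMass_swap_involutive e f).toPerm _).subtypeEquiv fun x => by
      simp only [Set.mem_setOf_eq, Function.Involutive.coe_toPerm]
      rw [nullMass_compress_eq_apply_swap e f x])

end Summit.PneNP.PneNP.Theorems.MonotoneSuffices.Compression
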